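import Summits.Ventures.GridStability.Lyapunov.StructurePreservingBlockRegion
import Summits.Ventures.GridStability.Lyapunov.StructurePreservingPolytopeRoa
import HarnessLib

/-!
# Signed couplings V — uniqueness of the synchronous equilibrium in the block region ((iii)′) and the
# WEIGHTED-LEG BLOCK Vu–Turitsyn theorem (card K1′): `BlockCover.sublevel_subset_regionOfAttraction`, `blockVT_holds`

Venture GRIDFUSION, G2-SCALE cell; card «idea-3 (cycle 4) / signed-coupling-triangle-absorption»
(HOME/IDEAS-G2.md § l.675; crit-1 GRADE PASS · NEW-COMBINATION, STATUS 2026-08-28T20:54:27Z); the planner's scratch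
proof `HOME/idea-3/c4/BlockRoaW.lean` (sha16 ce7574047d5005c1, 2 175 lines, farm rc 0 / 0 sorry / standard axioms,
crit-1 g2 independent check STATUS l.10676) filed in content by the cell's Lean-lane seat gridfusion-sos-5 (g11), split
into tree modules `StructurePreservingBlock{Energy,Rows,Cover,Region,Roa,Level,Toys}`; namespace renamed from
`…Ideas.TriangleAbsorption.Roa` to `…Lyapunov.StructurePreserving.SignedBlock`. 0 kit, 0 facts.
THREE COLUMNS: theorems about the MODELLED lossless structure-preserving model MV-3 with SIGNED couplings (negative
branch reactances: three-winding-transformer star equivalents, series capacitors); nothing here is a certificate for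
any benchmark and nothing here certifies a real grid.

WHAT THIS MODULE SAYS (`BlockRoaW.lean` §F–§G).  (iii)′: two synchronous equilibria on one momentum leaf inside the
region coincide — the tree's antisymmetric pairing identity `ΣΣ b(φᵢ−φⱼ)(sin σ − sin σ*) = 0` re-summed over the
cover: free terms `≥ 0` (Literature sector bound), block terms = block pairings `≥ 0` (module II), so all vanish;
strict sector / strict block sector force `φ` constant across free coupled pairs and across every triangle, hence
on the preconnected signed support; the momentum pins the constant.  With (i)′ (ii)′ of module IV and the LaSalle
piece (a complete trajectory with `V̇ ≡ 0` is the rest point) the Literature Barbashin–Krasovskii lemma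
`sublevel_subset_regionOfAttraction_of_noCompleteTrajectory` yields **K1′**: from every state of
`region ∩ constraintSet ∩ {V ≤ c}` a global solution exists, every solution stays there and tends to `(δ₀, 0)` —
the tree's `vtSublevel_subset_regionOfAttraction` with `hb : 0 ≤ b` replaced by «free coupling `≥ 0` on every pair +
frustrated triangles with their own coupling mass and valid closed-form rows; legs may be shared».  SOS-free; the
per-instance obligations are O(1) rational rows per triangle (module `…BlockLevel`).  MODELLED object: the lossless
constant-|V| structure-preserving model after exact star–mesh elimination of zero-injection midpoints (card MOVE E);
a theorem about model MV-3, not about any grid.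

* `blockSum_pairing_eq`, `blockPairing_nonneg_of_mem`, `eq_of_owns_of_x_eq_zero`,
  `eq_of_isSyncEquilibrium_of_momentum_eq` ((iii)′), `eq_equilibrium_of_fderiv_eq_zero` (LaSalle piece);
* **`BlockCover.sublevel_subset_regionOfAttraction`**, `equilibrium_mem_sublevel`, `BlockVT`, **`blockVT_holds`**.
-/

noncomputable section

open Set Filter Topology Real Finset
open Summit.Ventures.GridStability.Models.StructurePreserving
open Summit.Ventures.GridStability.Models.StructurePreserving.Params
open Summit.Ventures.GridStability.Lyapunov.StructurePreserving
open Literature.MathematicalPhysics.PowerSystems.ClassicalModel.LosslessSystem (vtGap vtGap_le_of_abs_eq)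
open Literature.MathematicalPhysics.PowerSystems (SinusoidalCoupling.sector_nonneg
  SinusoidalCoupling.sector_pos_of_abs_add_lt)

namespace Summit.Ventures.GridStability.Lyapunov.StructurePreserving.SignedBlock

variable {n : ℕ}

namespace BlockCover

variable {p : Params n} {δ₀ : Fin n → ℝ}

/-! ## §F. Uniqueness of the synchronous equilibrium in the region on its momentum leaf ((iii)′) -/

/-- The weighted block sum of the pairing family `(φᵢ − φⱼ)·(sin σᵢⱼ − sin σ*ᵢⱼ)` is the block pairing. -/
theorem blockSum_pairing_eq (K : Triangle n) (δ₀ δ : Fin n → ℝ) :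
    K.blockSum (fun i j => ((δ i - δ₀ i) - (δ j - δ₀ j))
        * (Real.sin (δ i - δ j) - Real.sin (δ₀ i - δ₀ j)))
      = blockPairing K.w₁ K.w₂ K.γ
          (δ₀ K.leg₁ - δ₀ K.apex) (δ₀ K.leg₂ - δ₀ K.apex) (δ₀ K.leg₁ - δ₀ K.leg₂)
          (K.x₁ δ₀ δ) (K.x₂ δ₀ δ) := by
  simp only [Triangle.blockSum, blockPairing, P, Triangle.x₁, Triangle.x₂]
  have e1 : δ₀ K.leg₁ - δ₀ K.apex + (δ K.leg₁ - δ K.apex - (δ₀ K.leg₁ - δ₀ K.apex)) = δ K.leg₁ - δ K.apex := by ring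
  have e2 : δ₀ K.leg₂ - δ₀ K.apex + (δ K.leg₂ - δ K.apex - (δ₀ K.leg₂ - δ₀ K.apex)) = δ K.leg₂ - δ K.apex := by ring
  have e3 : δ₀ K.leg₁ - δ₀ K.leg₂ + (δ K.leg₁ - δ K.apex - (δ₀ K.leg₁ - δ₀ K.apex)
      - (δ K.leg₂ - δ K.apex - (δ₀ K.leg₂ - δ₀ K.apex))) = δ K.leg₁ - δ K.leg₂ := by ring
  rw [e1, e2, e3]
  ring

/-- On the closed box the block pairing of the cover's triangle `k` is `≥ 0`, and `> 0` unless `x₁ = x₂ = 0`. -/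
theorem blockPairing_nonneg_of_mem (𝒦 : BlockCover p δ₀) (k : Fin 𝒦.t) {δ : Fin n → ℝ}
    (h1 : |(𝒦.tri k).x₁ δ₀ δ| ≤ (𝒦.tri k).ρ) (h2 : |(𝒦.tri k).x₂ δ₀ δ| ≤ (𝒦.tri k).ρ) :
    0 ≤ blockPairing (𝒦.tri k).w₁ (𝒦.tri k).w₂ (𝒦.tri k).γ (δ₀ (𝒦.tri k).leg₁ - δ₀ (𝒦.tri k).apex)
        (δ₀ (𝒦.tri k).leg₂ - δ₀ (𝒦.tri k).apex) (δ₀ (𝒦.tri k).leg₁ - δ₀ (𝒦.tri k).leg₂)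
        ((𝒦.tri k).x₁ δ₀ δ) ((𝒦.tri k).x₂ δ₀ δ) ∧
    (((𝒦.tri k).x₁ δ₀ δ ≠ 0 ∨ (𝒦.tri k).x₂ δ₀ δ ≠ 0) →
      0 < blockPairing (𝒦.tri k).w₁ (𝒦.tri k).w₂ (𝒦.tri k).γ (δ₀ (𝒦.tri k).leg₁ - δ₀ (𝒦.tri k).apex)
        (δ₀ (𝒦.tri k).leg₂ - δ₀ (𝒦.tri k).apex) (δ₀ (𝒦.tri k).leg₁ - δ₀ (𝒦.tri k).leg₂)
        ((𝒦.tri k).x₁ δ₀ δ) ((𝒦.tri k).x₂ δ₀ δ)) := by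
  obtain ⟨hβ₁, hβ₂⟩ := 𝒦.legs_pos k
  obtain ⟨hw₁, hw₂⟩ := 𝒦.window k
  obtain ⟨⟨e₁, e₁'⟩, ⟨e₂, e₂'⟩⟩ := 𝒦.row_q k
  obtain ⟨hq₁, hq₂, hrow⟩ := 𝒦.harmonic_q k
  have hγ : 0 ≤ (𝒦.tri k).γ := 𝒦.base_nonneg k
  have hρ := 𝒦.ρ_pos k
  exact ⟨blockPairing_nonneg_of_endpointRows hγ hβ₁ hβ₂ hρ hw₁ hw₂ e₁ e₁' e₂ e₂' hq₁ hq₂ hrow h1 h2,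
    fun hx => blockPairing_pos_of_endpointRows hγ hβ₁ hβ₂ hρ hw₁ hw₂ e₁ e₁' e₂ e₂' hq₁ hq₂ hrow h1 h2 hx⟩

/-- If both leg deviations of a triangle vanish, `φ` agrees across each of its pairs. -/
theorem eq_of_owns_of_x_eq_zero (K : Triangle n) {δ₀ δ : Fin n → ℝ} (h1 : K.x₁ δ₀ δ = 0)
    (h2 : K.x₂ δ₀ δ = 0) {u v : Fin n} (h : K.Owns u v) : δ u - δ₀ u = δ v - δ₀ v := by
  simp only [Triangle.x₁, Triangle.x₂] at h1 h2
  rcases h with h | h | h <;> rw [Sym2.eq_iff] at h <;> rcases h with ⟨rfl, rfl⟩ | ⟨rfl, rfl⟩ <;>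
    linarith

/-- **Inside the region the synchronous equilibrium is unique on its momentum leaf** (tree
`eq_of_isSyncEquilibrium_of_momentum_eq_vtPolytope` with the per-edge sector replaced by: sector on the
pairs with FREE coupling + strict block pairing on the triangles). -/
theorem eq_of_isSyncEquilibrium_of_momentum_eq (𝒦 : BlockCover p δ₀) (hp : p.WellFormed)
    (hn : n ≠ 0) (hconn : p.couplingGraph.Preconnected)
    (h0 : ∀ i j, 𝒦.bfree i j ≠ 0 → |δ₀ i - δ₀ j| < π / 2) {δ : Fin n → ℝ}
    (hP : ∀ i j, 𝒦.bfree i j ≠ 0 → |(δ i - δ j) + (δ₀ i - δ₀ j)| < π)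
    (hbox : ∀ k, |(𝒦.tri k).x₁ δ₀ δ| ≤ (𝒦.tri k).ρ ∧ |(𝒦.tri k).x₂ δ₀ δ| ≤ (𝒦.tri k).ρ)
    (hδ₀ : p.IsSyncEquilibrium δ₀) (hδ : p.IsSyncEquilibrium δ)
    (hL : p.momentum δ 0 = p.momentum δ₀ 0) : δ = δ₀ := by
  set φ : Fin n → ℝ := fun i => δ i - δ₀ i with hφ
  set A : Fin n → Fin n → ℝ := fun i j => Real.sin (δ i - δ j) - Real.sin (δ₀ i - δ₀ j) with hA
  have hanti : ∀ i j, A j i = -A i j := fun i j => by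
    simp only [hA]
    rw [← neg_sub (δ i) (δ j), ← neg_sub (δ₀ i) (δ₀ j), Real.sin_neg, Real.sin_neg]
    ring
  have hrow : ∀ i, ∑ j, p.b i j * A i j = p.pe δ i - p.pe δ₀ i := fun i => by
    simp only [hA, Params.pe, ← Finset.sum_sub_distrib]
    exact Finset.sum_congr rfl fun j _ => by ring
  have hzero : ∑ i, φ i * ∑ j, p.b i j * A i j = 0 :=
    Finset.sum_eq_zero fun i _ => by rw [hrow i, hδ i, hδ₀ i, sub_self, mul_zero]
  have hhalf := half_sum_sub_mul_antisymm p.b A φ hp.b_symm hanti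
  rw [hzero] at hhalf
  have hsum0 : ∑ i, ∑ j, p.b i j * ((φ i - φ j) * A i j) = 0 := by
    have h2 : (1 / 2 : ℝ) ≠ 0 := by norm_num
    exact (mul_eq_zero.1 hhalf).resolve_left h2
  -- re-sum the (symmetric) pairing family over the cover
  set g : Fin n → Fin n → ℝ := fun i j => (φ i - φ j) * A i j with hg
  have gsymm : ∀ i j, g j i = g i j := fun i j => by
    simp only [hg]; rw [hanti i j]; ring
  have hsplit := 𝒦.sum_sum_eq_free_add_blocks g gsymm
  rw [hsum0] at hsplit
  -- the block sums are the block pairings, all `≥ 0`; the free terms are `≥ 0`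
  have hblock : ∀ k, (𝒦.tri k).blockSum g
      = blockPairing (𝒦.tri k).w₁ (𝒦.tri k).w₂ (𝒦.tri k).γ (δ₀ (𝒦.tri k).leg₁ - δ₀ (𝒦.tri k).apex)
          (δ₀ (𝒦.tri k).leg₂ - δ₀ (𝒦.tri k).apex) (δ₀ (𝒦.tri k).leg₁ - δ₀ (𝒦.tri k).leg₂)
          ((𝒦.tri k).x₁ δ₀ δ) ((𝒦.tri k).x₂ δ₀ δ) := fun k => by
    rw [← blockSum_pairing_eq (𝒦.tri k) δ₀ δ]
  have hBnn : ∀ k, 0 ≤ (𝒦.tri k).blockSum g := fun k => by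
    rw [hblock k]; exact (𝒦.blockPairing_nonneg_of_mem k (hbox k).1 (hbox k).2).1
  have hφA : ∀ i j, (φ i - φ j) * A i j = ((δ i - δ j) - (δ₀ i - δ₀ j))
      * (Real.sin (δ i - δ j) - Real.sin (δ₀ i - δ₀ j)) := fun i j => by
    simp only [hφ, hA]
    ring
  have hgnn : ∀ i j, 𝒦.bfree i j ≠ 0 → 0 ≤ g i j := fun i j hb => by
    simp only [hg]; rw [hφA]
    exact SinusoidalCoupling.sector_nonneg (h0 i j hb).le (hP i j hb).le
  have hFnn : ∀ i j, 0 ≤ 𝒦.bfree i j * g i j := by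
    intro i j
    by_cases hb : 𝒦.bfree i j = 0
    · rw [hb, zero_mul]
    · exact mul_nonneg (𝒦.bfree_nonneg i j) (hgnn i j hb)
  have hF0 : ∑ i, ∑ j, 𝒦.bfree i j * g i j = 0 := by
    have h1 : 0 ≤ ∑ i, ∑ j, 𝒦.bfree i j * g i j :=
      Finset.sum_nonneg fun i _ => Finset.sum_nonneg fun j _ => hFnn i j
    have h2 : 0 ≤ ∑ k, (𝒦.tri k).blockSum g := Finset.sum_nonneg fun k _ => hBnn k
    linarith
  have hB0 : ∑ k, (𝒦.tri k).blockSum g = 0 := by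
    have h1 : 0 ≤ ∑ i, ∑ j, 𝒦.bfree i j * g i j :=
      Finset.sum_nonneg fun i _ => Finset.sum_nonneg fun j _ => hFnn i j
    have h2 : 0 ≤ ∑ k, (𝒦.tri k).blockSum g := Finset.sum_nonneg fun k _ => hBnn k
    linarith
  -- every block has `x₁ = x₂ = 0`
  have hx0 : ∀ k, (𝒦.tri k).x₁ δ₀ δ = 0 ∧ (𝒦.tri k).x₂ δ₀ δ = 0 := by
    intro k
    have hk := (Finset.sum_eq_zero_iff_of_nonneg fun k _ => hBnn k).1 hB0 k (Finset.mem_univ k)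
    by_contra hne
    have hne' : (𝒦.tri k).x₁ δ₀ δ ≠ 0 ∨ (𝒦.tri k).x₂ δ₀ δ ≠ 0 := by
      by_cases h1 : (𝒦.tri k).x₁ δ₀ δ = 0
      · exact Or.inr fun h2 => hne ⟨h1, h2⟩
      · exact Or.inl h1
    have hpos := (𝒦.blockPairing_nonneg_of_mem k (hbox k).1 (hbox k).2).2 hne'
    rw [← hblock k] at hpos
    exact absurd hk hpos.ne'
  -- hence `φ` agrees across every coupled pair
  have hedge : ∀ i j, p.couplingGraph.Adj i j → φ i = φ j := by
    intro i j hij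
    have hbij : p.b i j ≠ 0 := ((p.couplingGraph_adj_of_symm hp.b_symm i j).1 hij).2
    by_cases hf : 𝒦.bfree i j = 0
    · obtain ⟨k, hk⟩ := 𝒦.exists_owns_of_bfree_eq_zero hbij hf
      have := eq_of_owns_of_x_eq_zero (𝒦.tri k) (hx0 k).1 (hx0 k).2 hk
      simp only [hφ]
      exact this
    · have h1 := (Finset.sum_eq_zero_iff_of_nonneg fun i _ =>
        Finset.sum_nonneg fun j _ => hFnn i j).1 hF0 i (Finset.mem_univ i)
      have h2 := (Finset.sum_eq_zero_iff_of_nonneg fun j _ => hFnn i j).1 h1 j (Finset.mem_univ j)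
      have h3 : g i j = 0 := (mul_eq_zero.1 h2).resolve_left hf
      by_contra hne
      have hne' : δ i - δ j ≠ δ₀ i - δ₀ j := by
        intro h
        apply hne
        simp only [hφ]
        linarith
      have hpos := SinusoidalCoupling.sector_pos_of_abs_add_lt (h0 i j hf) (hP i j hf) hne'
      have h3' : (φ i - φ j) * A i j = 0 := by simpa only [hg] using h3
      rw [hφA] at h3'
      exact absurd h3' hpos.ne'
  -- preconnected: φ is constant; the momentum pins the constant
  obtain ⟨m, hm⟩ := Nat.exists_eq_succ_of_ne_zero hn
  subst hm
  have hconst : ∀ i, φ i = φ 0 := fun i => p.eq_of_reachable hedge (hconn i 0)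
  have hshift : δ = fun i => δ₀ i + φ 0 := by
    funext i
    have := hconst i
    simp only [hφ] at this
    linarith
  have hLs : p.momentum δ 0 = p.momentum δ₀ 0 + φ 0 * ∑ i, p.D i := by
    rw [hshift]
    exact p.momentum_shift δ₀ 0 (φ 0)
  have hc : φ 0 * ∑ i, p.D i = 0 := by linarith
  have hc0 : φ 0 = 0 := (mul_eq_zero.1 hc).resolve_right (sum_D_pos hp (Nat.succ_ne_zero m)).ne'
  rw [hshift, hc0]
  funext i
  simp

/-- **Hypothesis (iii) of Barbashin–Krasovskii on the region**: a global solution from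
`region ∩ constraintSet` along which `V̇ ≡ 0` is the rest point `(δ₀, 0)`. -/
theorem eq_equilibrium_of_fderiv_eq_zero (𝒦 : BlockCover p δ₀) (hp : p.WellFormed) (hn : n ≠ 0)
    (hconn : p.couplingGraph.Preconnected)
    (h0 : ∀ i j, 𝒦.bfree i j ≠ 0 → |δ₀ i - δ₀ j| < π / 2)
    (hδ₀ : p.IsSyncEquilibrium δ₀)
    {Y : ℝ → (Fin n → ℝ) × (Fin n → ℝ)} (hY0 : Y 0 ∈ 𝒦.region ∩ constraintSet p δ₀)
    (hY : ∀ T : ℝ, ∀ t ∈ Icc 0 T, HasDerivWithinAt Y (phaseField p (Y t)) (Icc 0 T) t)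
    (hzero : ∀ t, 0 ≤ t → fderiv ℝ (phaseEnergy p δ₀) (Y t) (phaseField p (Y t)) = 0) :
    Y 0 = (δ₀, 0) := by
  have hF1 : ∀ t, 0 ≤ t → ∀ i, (phaseField p (Y t)).1 i = 0 := fun t ht i =>
    phaseField_fst_eq_zero_of_fderiv_eq_zero hp hδ₀ (hzero t ht) i
  have hω : ∀ t, 0 ≤ t → ∀ i ∈ p.gen, (Y t).2 i = 0 := fun t ht i hi => by
    rw [← phaseField_fst_of_mem p (Y t) hi]
    exact hF1 t ht i
  have hF2 : ∀ i ∈ p.gen, (phaseField p (Y 0)).2 i = 0 := fun i hi => by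
    set π₂ : ((Fin n → ℝ) × (Fin n → ℝ)) →L[ℝ] ℝ :=
      (ContinuousLinearMap.proj i).comp (ContinuousLinearMap.snd ℝ (Fin n → ℝ) (Fin n → ℝ))
      with hπ₂
    have hπ : ∀ x : (Fin n → ℝ) × (Fin n → ℝ), π₂ x = x.2 i := fun x => rfl
    have h1 : HasDerivWithinAt (⇑π₂ ∘ Y) (π₂ (phaseField p (Y 0))) (Icc 0 1) 0 :=
      π₂.hasFDerivAt.comp_hasDerivWithinAt (0 : ℝ) (hY 1 0 ⟨le_rfl, zero_le_one⟩)
    have h2 : HasDerivWithinAt (⇑π₂ ∘ Y) 0 (Icc 0 1) 0 :=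
      ((hasDerivAt_const (0 : ℝ) (0 : ℝ)).hasDerivWithinAt (s := Icc 0 1)).congr
        (fun s hs => by
          show π₂ (Y s) = 0
          rw [hπ]
          exact hω s hs.1 i hi)
        (by
          show π₂ (Y 0) = 0
          rw [hπ]
          exact hω 0 le_rfl i hi)
    have h := (uniqueDiffOn_Icc_zero_one 0 ⟨le_rfl, zero_le_one⟩).eq_deriv _ h1 h2
    rwa [hπ] at h
  have hpe : p.IsSyncEquilibrium (Y 0).1 := fun i => by
    by_cases hi : i ∈ p.gen
    · have h := hF2 i hi
      rw [phaseField_snd_of_mem p (Y 0) hi, hω 0 le_rfl i hi, mul_zero, sub_zero] at h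
      rcases div_eq_zero_iff.1 h with h | h
      · linarith
      · exact absurd h (hp.M_pos i hi).ne'
    · have h := hF1 0 le_rfl i
      rw [phaseField_fst_of_not_mem p (Y 0) hi] at h
      rcases div_eq_zero_iff.1 h with h | h
      · linarith
      · exact absurd h (hp.D_pos i).ne'
  have hY2 : (Y 0).2 = 0 := funext fun i => by
    by_cases hi : i ∈ p.gen
    · exact hω 0 le_rfl i hi
    · exact hY0.2.2 i hi
  have hL : p.momentum (Y 0).1 0 = p.momentum δ₀ 0 := by
    have h := hY0.2.1
    rwa [hY2] at h
  have hδ := 𝒦.eq_of_isSyncEquilibrium_of_momentum_eq hp hn hconn h0 hY0.1.1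
    (fun k => ⟨(hY0.1.2 k).1.le, (hY0.1.2 k).2.le⟩) hδ₀ hpe hL
  exact Prod.ext hδ hY2

/-! ## §G. Assembly: the weighted-leg block Vu–Turitsyn theorem (K1′) -/

/-- **K1′ — synchronisation of the structure-preserving model from the block region with the closed-form
level** (the tree's `vtSublevel_subset_regionOfAttraction` with `hb : 0 ≤ b` replaced by «free coupling
`≥ 0` on every pair + triangles with their own coupling mass and valid closed-form rows; legs may be shared»). -/
theorem sublevel_subset_regionOfAttraction (𝒦 : BlockCover p δ₀) (hp : p.WellFormed) (hn : n ≠ 0)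
    (hconn : p.couplingGraph.Preconnected)
    (h0 : ∀ i j, 𝒦.bfree i j ≠ 0 → |δ₀ i - δ₀ j| < π / 2)
    (hδ₀ : p.IsSyncEquilibrium δ₀) {c : ℝ} (hc : 𝒦.LevelBelowFaces c)
    {y : (Fin n → ℝ) × (Fin n → ℝ)}
    (hy : y ∈ 𝒦.region ∩ constraintSet p δ₀ ∧ phaseEnergy p δ₀ y ≤ c) :
    (∃ X : ℝ → (Fin n → ℝ) × (Fin n → ℝ), X 0 = y ∧
      ∀ T : ℝ, ∀ t ∈ Icc 0 T, HasDerivWithinAt X (phaseField p (X t)) (Icc 0 T) t) ∧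
    ∀ X : ℝ → (Fin n → ℝ) × (Fin n → ℝ), X 0 = y →
      (∀ T : ℝ, ∀ t ∈ Icc 0 T, HasDerivWithinAt X (phaseField p (X t)) (Icc 0 T) t) →
      (∀ t, 0 ≤ t → X t ∈ 𝒦.region ∩ constraintSet p δ₀ ∧ phaseEnergy p δ₀ (X t) ≤ c) ∧
        Tendsto X atTop (𝓝 (δ₀, 0)) :=
  Literature.Analysis.ODE.sublevel_subset_regionOfAttraction_of_noCompleteTrajectory
    (F := phaseField p) (V := phaseEnergy p δ₀) (V' := fderiv ℝ (phaseEnergy p δ₀))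
    (G := 𝒦.region) (M := constraintSet p δ₀) 𝒦.isOpen_region
    (fun x _ => (((contDiff_phaseEnergy p δ₀).differentiable one_ne_zero) x).hasFDerivAt)
    (fun x _ => fderiv_phaseEnergy_phaseField_nonpos hp hδ₀ x)
    (𝒦.isCompact_sublevel hp hn hconn (fun i j hij => (h0 i j hij).le) hc)
    (contDiff_phaseField p)
    (fun _ hY0 hY hzero => 𝒦.eq_equilibrium_of_fderiv_eq_zero hp hn hconn h0 hδ₀ hY0.1 hY hzero)
    (fun z hz _ X hX0 hX => mem_constraintSet_of_solution hp hn δ₀ hX (by rw [hX0]; exact hz.1.2))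
    hy

/-- The equilibrium state itself lies in the certified set whenever `0 ≤ c`. -/
theorem equilibrium_mem_sublevel (𝒦 : BlockCover p δ₀)
    (h0 : ∀ i j, 𝒦.bfree i j ≠ 0 → |δ₀ i - δ₀ j| < π / 2) {c : ℝ} (hc : 0 ≤ c) :
    ((δ₀, 0) : (Fin n → ℝ) × (Fin n → ℝ)) ∈ 𝒦.region ∩ constraintSet p δ₀ ∧
      phaseEnergy p δ₀ ((δ₀, 0) : (Fin n → ℝ) × (Fin n → ℝ)) ≤ c := by
  refine ⟨⟨⟨fun i j hij => ?_, fun k => ?_⟩, equilibrium_mem_constraintSet p δ₀⟩, ?_⟩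
  · have h := abs_lt.1 (h0 i j hij)
    rw [abs_lt]
    constructor <;> linarith [h.1, h.2]
  · simp only [Triangle.x₁, Triangle.x₂, sub_self, abs_zero]
    exact ⟨𝒦.ρ_pos k, 𝒦.ρ_pos k⟩
  · have hV : phaseEnergy p δ₀ ((δ₀, 0) : (Fin n → ℝ) × (Fin n → ℝ)) = 0 := by
      simp [phaseEnergy, Params.energy, Params.kinetic, Params.potential]
    rw [hV]
    exact hc

end BlockCover

/-- **K1′ as a closed statement** — the weighted-leg BLOCK Vu–Turitsyn synchronisation theorem for SIGNED
structure-preserving data: for every `n`, well-formed `p` on `n ≠ 0` buses with preconnected coupling graph,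
synchronous equilibrium `δ₀`, block cover `𝒦` with the equilibrium window on free coupled pairs, and level `c` below
the faces, every state of `𝒦.region ∩ constraintSet ∩ {V ≤ c}` has a global solution, every global solution stays
there and tends to `(δ₀, 0)`.  PROVED below (`blockVT_holds`); stated as a `Prop` so that instances can cite the
sentence by name.  MODELLED object MV-3 (lossless, constant |V|, signed couplings); not about any grid.
[cite: VuTuritsyn2016, §IV (ℛ = {x ∈ 𝒫 : V < V_min}) and Appendix 9.2–9.3] (polytope certificate, as the tree's
`vtSublevel_subset_regionOfAttraction`; the block variant is this cell's card «signed-coupling-triangle-absorption» K1′) -/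
def BlockVT : Prop :=
  ∀ (n : ℕ) (p : Params n), p.WellFormed → n ≠ 0 → p.couplingGraph.Preconnected →
    ∀ (δ₀ : Fin n → ℝ), p.IsSyncEquilibrium δ₀ → ∀ (𝒦 : BlockCover p δ₀),
    (∀ i j, 𝒦.bfree i j ≠ 0 → |δ₀ i - δ₀ j| < π / 2) →
    ∀ (c : ℝ), 𝒦.LevelBelowFaces c →
    ∀ (y : (Fin n → ℝ) × (Fin n → ℝ)),
      y ∈ 𝒦.region ∩ constraintSet p δ₀ ∧ phaseEnergy p δ₀ y ≤ c →
      (∃ X : ℝ → (Fin n → ℝ) × (Fin n → ℝ), X 0 = y ∧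
        ∀ T : ℝ, ∀ t ∈ Icc 0 T, HasDerivWithinAt X (phaseField p (X t)) (Icc 0 T) t) ∧
      ∀ X : ℝ → (Fin n → ℝ) × (Fin n → ℝ), X 0 = y →
        (∀ T : ℝ, ∀ t ∈ Icc 0 T, HasDerivWithinAt X (phaseField p (X t)) (Icc 0 T) t) →
        (∀ t, 0 ≤ t → X t ∈ 𝒦.region ∩ constraintSet p δ₀ ∧ phaseEnergy p δ₀ (X t) ≤ c) ∧
          Tendsto X atTop (𝓝 (δ₀, 0))

/-- **K1′ PROVED.** -/
theorem blockVT_holds : BlockVT :=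
  fun _ _ hp hn hconn _ hδ₀ 𝒦 h0 _ hc _ hy =>
    𝒦.sublevel_subset_regionOfAttraction hp hn hconn h0 hδ₀ hc hy

end Summit.Ventures.GridStability.Lyapunov.StructurePreserving.SignedBlock

end
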